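import Mathlib
import Summits.HodgeConjecture.HodgeConjecture.Theses.HeckePrymWeil

/-!
# Sketch — crux-ideate r1, ideator k = 3, crux `WeilSixfoldsSqrtMinus7` (stmt-HodgeConjecture-1260)

First-lemma signatures for the crux idea `e6-dominant-eigen-excess` (and the linear-algebra core
of the barrier notes in NOTES.md).  Nothing here is a proof of the crux; `sorry` only in bodies of
the two sketched lemmas.

* `crux_unfold` : the crux is polarization-free and family-free — it quantifies over ALL `(A, φ)`;
  hence algebraicity on the image of ANY dominant family plus closedness of the algebraic locus
  decides it (the E₆ line needs no transport item).
* `baire_spreading` : the topological skeleton of "algebraic on a (Euclidean-)open set of an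
  irreducible component ⇒ on a set with non-empty interior of some closed stratum" (closedness of
  the algebraicity locus = countable union of closed algebraic subsets, Voisin/CDK; used exactly as
  in arXiv:2502.03415 §1.5 and route TropicalCuspLift's `BaireSpreading`).
* `blind_adjoin` : BLINDNESS LEMMA (linear-algebra core).  On `H¹` of a Weil-type abelian variety
  the Weil generator `φ` is skew-adjoint for the polarization form `E`; therefore every element
  `ψ ∈ ℚ[φ]` has SYMMETRISED form `E(ψx,y)+E(x,ψy)` equal to a rational multiple of `E`.  Geometric
  reading (NOTES.md §Blindness): cohomology classes of incidence / graph-calculus cycles on `C̃^N`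
  built from correspondences in `ℚ[T_φ, symmetric ones]` lie in the divisor algebra `ℚ[θ, q_D, …]`
  — they never see the Weil class; the cycle of the E₆ line must be an EXCESS locus.
-/

namespace Summit.HodgeConjecture.HodgeConjecture.Cruxes.WeilSixfoldsSqrtMinus7.IdeatorThree

open CategoryTheory Literature.AlgebraicGeometry

/-- The crux, verbatim, as a predicate on a pair `(A, φ)`. -/
def WeilAlg72 (A : Motives.AbelianVariety ℂ) (φ : A ⟶ A) : Prop :=
  A.dim = 6 → CategoryStruct.comp φ φ = -((7 : ℤ) • CategoryStruct.id A) →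
    ∀ c : HodgeTheory.complexBetti A.X 6, HodgeTheory.IsRationalClass c →
      HodgeTheory.IsOfHodgeType 6 A.X 6 3 3 c →
      c ∈ Module.End.eigenspace (HodgeTheory.complexBetti.map
            (CategoryStruct.id A + φ).hom.hom.hom 6).hom ((1 + Complex.I * (Real.sqrt (7 : ℝ) : ℂ)) ^ 6) ⊔
          Module.End.eigenspace (HodgeTheory.complexBetti.map
            (CategoryStruct.id A + φ).hom.hom.hom 6).hom ((1 - Complex.I * (Real.sqrt (7 : ℝ) : ℂ)) ^ 6) →
      c ∈ HodgeTheory.algebraicClasses A.X 3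

/-- The crux quantifies over all `(A, φ)` and mentions no polarization, no family, no cover:
any dominant family onto each component decides it once closedness is in hand. -/
theorem crux_unfold :
    Theses.HeckePrymWeil.WeilSixfoldsSqrtMinus7 ↔
      ∀ (A : Motives.AbelianVariety ℂ) (φ : A ⟶ A), WeilAlg72 A φ :=
  Iff.rfl

/-- Baire skeleton of SPREADING (closedness ⇒ a dominant family suffices): in a non-empty
Baire space (e.g. a Euclidean-open subset of the irreducible family, with the induced topology),
if countably many closed sets (the algebraicity strata, Voisin/CDK) cover it, one of them has
non-empty interior.  With irreducibility and algebraicity of the strata this gives "everywhere". -/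
theorem baire_spreading {X : Type*} [TopologicalSpace X] [BaireSpace X] [Nonempty X]
    (Z : ℕ → Set X) (hZ : ∀ i, IsClosed (Z i)) (hcov : (⋃ i, Z i) = Set.univ) :
    ∃ i, (interior (Z i)).Nonempty :=
  nonempty_interior_of_iUnion_of_closed hZ hcov

/-- **Blindness lemma (linear-algebra core).**  `E` alternating, `φ` skew-adjoint for `E` with
`φ² = -d`: for every `ψ` in the subalgebra `ℚ[φ]`, the symmetrised form `E(ψ x, y) + E(x, ψ y)` is a
rational multiple of `E` (namely `2·(even part of ψ evaluated at φ² = -d)`).  Consequence recorded in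
NOTES.md: the alternating `2`-tensor `q_ψ` attached to a correspondence acting through `ℚ[φ]` on the
Weil part is a multiple of the polarization class, so incidence cycles are cohomologically blind to
the Weil class. -/
theorem blind_adjoin {V : Type*} [AddCommGroup V] [Module ℚ V]
    (E : LinearMap.BilinForm ℚ V) (hE : ∀ x y, E x y = -E y x)
    (φ : V →ₗ[ℚ] V) (d : ℚ) (hφ2 : φ ∘ₗ φ = -(d • LinearMap.id))
    (hφ : ∀ x y, E (φ x) y = -E x (φ y))
    (ψ : V →ₗ[ℚ] V) (hψ : ψ ∈ Algebra.adjoin ℚ ({φ} : Set (V →ₗ[ℚ] V))) :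
    ∃ c : ℚ, ∀ x y, E (ψ x) y + E x (ψ y) = c * E x y := by
  sorry

end Summit.HodgeConjecture.HodgeConjecture.Cruxes.WeilSixfoldsSqrtMinus7.IdeatorThree
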